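import Summits.Ventures.YMGap.Census.PotentialMoving
import Summits.Ventures.YMGap.Census.TwistSheet
import HarnessLib

/-!
# Venture YMGap, track (b) — potential moving IN THE PRESENCE OF FLUX (Tomboulis, arXiv:0707.2179, App. A §4, the twisted (A.19))

HONEST FRAMING: venture file of the cell `pub-ymgap` (QuantumFields programme), track (b); finite tori `(ℤ/bLℤ)^d` only, on the
positivity domain `f_c ≥ 0`; nothing about (5.15), limits, confinement or a mass gap.  `PotentialMoving` with a twist: the plaquette
function is `f_c(-U_p)` on a plaquette set `V` and `f_c(U_p)` off `V` (`twR`), raised to an exponent field (`tPowFieldFn`, `tPowFieldZ`).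
T07: "there is still translational invariance … in the presence of the flux … a consequence of the basic property that `Z⁻` does not
depend on the location but only the homology class of `𝒱`."  Kernel form: `tPowFieldZ_symmDiff_coboundary` (mod-2 rule for every
exponent field), `coboundary_sheetLinksSnd` + `tPowFieldZ_sheetAt_eq` (the sheet relocates in BOTH in-plane coordinates),
`tPowFieldZ_sheet_comp_plaqShift` (translation invariance), `tPowFieldZ_le_tPowFieldZ_moveExp` (the AM–GM move, verbatim as untwisted),
`torusZtw_fine_le_tPowFieldZ_mkExp`: **`Z⁻_{(ℤ/bL)^d}({c_j}) ≤ ∫ ∏_{p on the coarse 2-skeleton} f_c(∓U_p)^{b^{d-2}}`** for every `d, b, L, J`.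
[cite: Tomboulis2007Confinement, App. A §4 (A.15)–(A.19) and the paragraph "The proof of III.1 can be used essentially unaltered to obtain IV.3"]
-/

noncomputable section

open MeasureTheory Finset Real
open scoped BigOperators symmDiff
open Literature.MathematicalPhysics.QuantumLattice
open Literature.MathematicalPhysics.QuantumFieldTheory
open Literature.MathematicalPhysics.QuantumFieldTheory.Tomboulis2007
open Literature.MathematicalPhysics.QuantumFieldTheory.WilsonRP
open Summit.Ventures.LatticeQCDFlow.Exactness
open Summit.Ventures.LatticeQCDFlow.Scoring

namespace Summit.Ventures.YMGap.Census

variable {d L : ℕ}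

/-! ### Twisted exponent fields -/

/-- The twisted plaquette weight as a function of `r = Re tr U_p`: `f_c(-U_p)` on `V`, `f_c(U_p)` off `V`. -/
def twR [NeZero L] (J : ℕ) (c : ℕ → ℝ) (V : Finset (Plaquette d L)) (p : Plaquette d L) (r : ℝ) : ℝ :=
  if p ∈ V then charSum J (twistVec (stdCoef c)) r else charSum J (stdCoef c) r

/-- The integrand `∏_p f_c(∓U_p)^{e_p}` of an exponent field `e` with twist set `V`. -/
def tPowFieldFn [NeZero L] (J : ℕ) (c : ℕ → ℝ) (V : Finset (Plaquette d L)) (e : Plaquette d L → ℕ)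
    (W : GaugeConfig d L SU2) : ℝ :=
  ∏ p, twR J c V p (plaqRe rhoFund W p) ^ e p

/-- **The twisted partition function of an exponent field** `Z⁻(V; e) = ∫ ∏_p f_c(∓U_p)^{e_p} ∏_b dU_b`. -/
def tPowFieldZ [NeZero L] (J : ℕ) (c : ℕ → ℝ) (V : Finset (Plaquette d L)) (e : Plaquette d L → ℕ) : ℝ :=
  ∫ W, tPowFieldFn J c V e W ∂(Measure.pi fun _ : Edge d L => haarProbability SU2)

section Basic

variable [NeZero L]

/-- Off the twist set the weight is `f_c`. -/
theorem twR_of_not_mem (J : ℕ) (c : ℕ → ℝ) {V : Finset (Plaquette d L)} {p : Plaquette d L} (hp : p ∉ V) (r : ℝ) :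
    twR J c V p r = fR J c r := by
  rw [twR, if_neg hp, charSum_stdCoef]

/-- On the twist set the weight is `f_c(-·)`. -/
theorem twR_of_mem (J : ℕ) (c : ℕ → ℝ) {V : Finset (Plaquette d L)} {p : Plaquette d L} (hp : p ∈ V) (r : ℝ) :
    twR J c V p r = fR J c (-r) := by
  rw [twR, if_pos hp, ← charSum_neg, charSum_stdCoef]

/-- With no twist this is `powFieldFn`. -/
theorem tPowFieldFn_empty (J : ℕ) (c : ℕ → ℝ) (e : Plaquette d L → ℕ) (W : GaugeConfig d L SU2) :
    tPowFieldFn J c ∅ e W = powFieldFn J c e W := by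
  unfold tPowFieldFn powFieldFn
  exact Finset.prod_congr rfl fun p _ => by rw [twR_of_not_mem J c (Finset.notMem_empty p)]

/-- `Z⁻_Λ({c_j}; V)` is the twisted partition function of the constant exponent field `1`. -/
theorem torusZtw_eq_tPowFieldZ_one (J : ℕ) (c : ℕ → ℝ) (V : Finset (Plaquette d L)) :
    torusZtw d L J c V = tPowFieldZ J c V (fun _ : Plaquette d L => 1) := by
  unfold torusZtw tPowFieldZ tPowFieldFn
  refine integral_congr_ae (ae_of_all _ fun W => Finset.prod_congr rfl fun p _ => ?_)
  rw [pow_one, twR]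
  by_cases hp : p ∈ V
  · rw [if_pos hp, if_pos hp, charSum_twistVec_stdCoef]
  · rw [if_neg hp, if_neg hp, charSum_stdCoef, plaqFn_hol_eq_fR]

/-- The twisted weight of a plaquette is a value of `f_c` on `SU(2)` (at `-U_p` resp. `U_p`). -/
theorem twR_plaqRe_eq (J : ℕ) (c : ℕ → ℝ) (V : Finset (Plaquette d L)) (p : Plaquette d L) (W : GaugeConfig d L SU2) :
    twR J c V p (plaqRe rhoFund W p) =
      if p ∈ V then plaqFn J c (negOne * plaquetteHolonomy W p.1 p.2.1.1 p.2.1.2)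
        else plaqFn J c (plaquetteHolonomy W p.1 p.2.1.1 p.2.1.2) := by
  rw [twR]
  by_cases hp : p ∈ V
  · rw [if_pos hp, if_pos hp, charSum_twistVec_stdCoef, plaqFn_negOne_mul]
  · rw [if_neg hp, if_neg hp, charSum_stdCoef, plaqFn_hol_eq_fR]

/-- The twisted integrand is non-negative on the positivity domain `f_c ≥ 0`. -/
theorem tPowFieldFn_nonneg (J : ℕ) {c : ℕ → ℝ} (hf : ∀ g : SU2, 0 ≤ plaqFn J c g) (V : Finset (Plaquette d L))
    (e : Plaquette d L → ℕ) (W : GaugeConfig d L SU2) : 0 ≤ tPowFieldFn J c V e W :=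
  Finset.prod_nonneg fun p _ => pow_nonneg (by rw [twR_plaqRe_eq]; split_ifs <;> exact hf _) _

/-- The twisted weight is continuous in `r`. -/
theorem continuous_twR (J : ℕ) (c : ℕ → ℝ) (V : Finset (Plaquette d L)) (p : Plaquette d L) : Continuous (twR J c V p) := by
  unfold twR charSum charR
  split_ifs <;> exact continuous_finsetSum _ fun n _ => continuous_const.mul ((Polynomial.continuous _).comp (continuous_id.div_const _))

/-- The twisted integrand is continuous. -/
theorem continuous_tPowFieldFn (J : ℕ) (c : ℕ → ℝ) (V : Finset (Plaquette d L)) (e : Plaquette d L → ℕ) :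
    Continuous (tPowFieldFn J c V e) := by
  unfold tPowFieldFn
  exact continuous_finsetProd _ fun p _ => ((continuous_twR J c V p).comp (continuous_plaqRe p)).pow _

/-! ### Translations: the twist set moves with the lattice -/

/-- The pulled-back twist set `τ_v^* V = {p : p + v ∈ V}`. -/
def pullTwist (v : Site d L) (V : Finset (Plaquette d L)) : Finset (Plaquette d L) := univ.filter fun p => plaqShift v p ∈ V

/-- Membership in the pulled-back twist set (plumbing). -/
theorem mem_pullTwist (v : Site d L) (V : Finset (Plaquette d L)) (p : Plaquette d L) : p ∈ pullTwist v V ↔ plaqShift v p ∈ V := by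
  simp [pullTwist]

/-- The twisted integrand intertwines lattice translations (twist set and exponent field both pulled back). -/
theorem tPowFieldFn_configShift (J : ℕ) (c : ℕ → ℝ) (V : Finset (Plaquette d L)) (e : Plaquette d L → ℕ) (v : Site d L)
    (W : GaugeConfig d L SU2) :
    tPowFieldFn J c (pullTwist v V) (fun p => e (plaqShift v p)) (configShift v W) = tPowFieldFn J c V e W := by
  unfold tPowFieldFn
  simp only [plaqRe_configShift]
  refine Fintype.prod_equiv (plaqShiftEquiv v) _ _ fun p => ?_
  rw [plaqShiftEquiv_apply]
  congr 1
  unfold twR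
  simp only [mem_pullTwist]

/-- **Translation covariance**: `Z⁻(τ_v^* V; e ∘ τ_v) = Z⁻(V; e)`. -/
theorem tPowFieldZ_comp_plaqShift (J : ℕ) (c : ℕ → ℝ) (V : Finset (Plaquette d L)) (e : Plaquette d L → ℕ) (v : Site d L) :
    tPowFieldZ J c (pullTwist v V) (fun p => e (plaqShift v p)) = tPowFieldZ J c V e := by
  unfold tPowFieldZ
  rw [← (measurePreserving_configShiftEquiv (haarProbability SU2) v).integral_comp'
    (tPowFieldFn J c (pullTwist v V) fun p => e (plaqShift v p))]
  refine integral_congr_ae (ae_of_all _ fun W => ?_)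
  simp only [configShiftEquiv_apply, tPowFieldFn_configShift]

/-! ### The mod-2 rule for exponent fields -/

/-- Under `U_b ↦ -U_b` (`b ∈ E`) the twisted weight of `p` for the twist set `V` becomes the one for `V ∆ δE`. -/
theorem twR_plaqRe_flipLinks (J : ℕ) (c : ℕ → ℝ) (V : Finset (Plaquette d L)) (E : Finset (Edge d L))
    (W : GaugeConfig d L SU2) (p : Plaquette d L) :
    twR J c V p (plaqRe rhoFund (flipLinks E W) p) = twR J c (V ∆ coboundary E) p (plaqRe rhoFund W p) := by
  unfold twR
  by_cases hV : p ∈ V <;> by_cases hE : p ∈ coboundary E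
  · have h : p ∉ V ∆ coboundary E := by rw [Finset.mem_symmDiff]; tauto
    rw [if_pos hV, if_neg h, charSum_plaqRe_flipLinks, if_pos hE, twistVec_twistVec]
  · have h : p ∈ V ∆ coboundary E := Finset.mem_symmDiff.2 (Or.inl ⟨hV, hE⟩)
    rw [if_pos hV, if_pos h, charSum_plaqRe_flipLinks, if_neg hE]
  · have h : p ∈ V ∆ coboundary E := Finset.mem_symmDiff.2 (Or.inr ⟨hE, hV⟩)
    rw [if_neg hV, if_pos h, charSum_plaqRe_flipLinks, if_pos hE]
  · have h : p ∉ V ∆ coboundary E := by rw [Finset.mem_symmDiff]; tauto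
    rw [if_neg hV, if_neg h, charSum_plaqRe_flipLinks, if_neg hE]

/-- **Tomboulis's mod-2 rule for exponent fields**: `Z⁻(V ∆ δE; e) = Z⁻(V; e)` for every `V`, `E`, `e` (the change of
variables `U_b ↦ -U_b`, `b ∈ E`). [cite: Tomboulis2007Confinement, §4 (text after (4.1)); App. A §4] -/
theorem tPowFieldZ_symmDiff_coboundary (J : ℕ) (c : ℕ → ℝ) (V : Finset (Plaquette d L)) (E : Finset (Edge d L))
    (e : Plaquette d L → ℕ) : tPowFieldZ J c (V ∆ coboundary E) e = tPowFieldZ J c V e := by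
  have hmp : MeasurePreserving (flipEquiv E) (Measure.pi fun _ : Edge d L => haarProbability SU2)
      (Measure.pi fun _ : Edge d L => haarProbability SU2) := measurePreserving_flipLinks E
  unfold tPowFieldZ
  refine Eq.trans ?_ (hmp.integral_comp' (tPowFieldFn J c V e))
  refine integral_congr_ae (ae_of_all _ fun W => ?_)
  change tPowFieldFn J c (V ∆ coboundary E) e W = tPowFieldFn J c V e (flipLinks E W)
  unfold tPowFieldFn
  exact Finset.prod_congr rfl fun p _ => by rw [twR_plaqRe_flipLinks]

/-- Symmetric form: `V ∆ V' = δE ⟹ Z⁻(V; e) = Z⁻(V'; e)`. -/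
theorem tPowFieldZ_congr_coboundary (J : ℕ) (c : ℕ → ℝ) {V V' : Finset (Plaquette d L)} (E : Finset (Edge d L))
    (h : V ∆ V' = coboundary E) (e : Plaquette d L → ℕ) : tPowFieldZ J c V e = tPowFieldZ J c V' e := by
  have hV' : V' = V ∆ coboundary E := by rw [← h, ← symmDiff_assoc, symmDiff_self, bot_symmDiff]
  rw [hV', tPowFieldZ_symmDiff_coboundary]

/-! ### Relocating the sheet in the second in-plane coordinate -/

/-- The `i`-links between the sheets at `(a, b)` and `(a, b + 1)`: `(x, i)` with `x_i = a`, `x_j = b + 1`. -/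
def sheetLinksSnd (i j : Fin d) (a b : ZMod L) : Finset (Edge d L) :=
  univ.filter fun e => e.2 = i ∧ e.1 i = a ∧ e.1 j = b + 1

/-- Membership in `sheetLinksSnd` (plumbing). -/
theorem mem_sheetLinksSnd (i j : Fin d) (a b : ZMod L) (y : Site d L) (m : Fin d) : (y, m) ∈ sheetLinksSnd i j a b ↔ m = i ∧ y i = a ∧ y j = b + 1 := by
  simp [sheetLinksSnd]

/-- **`δ(sheetLinksSnd a b) = sheet(a, b) ∆ sheet(a, b + 1)`**: adjacent parallel sheets differing in the SECOND coordinate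
cobound a link set (companion of `coboundary_sheetLinksAt`). -/
theorem coboundary_sheetLinksSnd {i j : Fin d} (hij : i < j) (a b : ZMod L) :
    coboundary (sheetLinksSnd (L := L) i j a b) = sheetAt i j hij a b ∆ sheetAt i j hij a (b + 1) := by
  ext p
  rcases p with ⟨y, ⟨⟨a', b'⟩, hab⟩⟩
  rw [mem_coboundary, Finset.mem_symmDiff, mem_sheetAt, mem_sheetAt]
  simp only [flipCount, linkInd, mem_sheetLinksSnd]
  by_cases ha : a' = i
  · subst ha
    by_cases hb : b' = j
    · subst hb
      have h1 : (y.shift b') a' = y a' := by simp [Site.shift, Pi.single_eq_of_ne hab.ne]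
      have h2 : (y.shift b') b' = y b' + 1 := by simp [Site.shift]
      simp only [h1, h2, hab.ne', false_and, if_false, add_zero, add_left_inj, true_and]
      rw [odd_ite_add_ite']
      tauto
    · -- plane `(i, b')`, `b' ≠ j`: both `i`-links see the same condition
      have hne : ¬((⟨(a', b'), hab⟩ : {p : Fin d × Fin d // p.1 < p.2}) = ⟨(a', j), hij⟩) := by
        intro h
        exact hb (congrArg (fun q : {p : Fin d × Fin d // p.1 < p.2} => q.1.2) h)
      have h1 : (y.shift b') a' = y a' := by simp [Site.shift, Pi.single_eq_of_ne hab.ne]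
      have h2 : (y.shift b') j = y j := by simp [Site.shift, Pi.single_eq_of_ne (Ne.symm hb)]
      simp only [h1, h2, hab.ne', false_and, if_false, add_zero, true_and, hne, not_false_iff, and_true,
        or_self, iff_false]
      exact not_odd_ite_add_self' _
  · by_cases hb : b' = i
    · subst hb
      -- plane `(a', i)` with `a' < i`: the `i`-links are `(y + e_{a'}, i)` and `(y, i)`
      have hne : ¬((⟨(a', b'), hab⟩ : {p : Fin d × Fin d // p.1 < p.2}) = ⟨(b', j), hij⟩) := by
        intro h
        exact ha (congrArg (fun q : {p : Fin d × Fin d // p.1 < p.2} => q.1.1) h)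
      have h1 : (y.shift a') b' = y b' := by simp [Site.shift, Pi.single_eq_of_ne hab.ne']
      have h2 : (y.shift a') j = y j := by simp [Site.shift, Pi.single_eq_of_ne (hab.trans hij).ne']
      simp only [h1, h2, ha, false_and, if_false, zero_add, add_zero, true_and, hne, not_false_iff, and_true, or_self,
        iff_false]
      exact not_odd_ite_add_self' _
    · have hne : ¬((⟨(a', b'), hab⟩ : {p : Fin d × Fin d // p.1 < p.2}) = ⟨(i, j), hij⟩) := by
        intro h
        exact ha (congrArg (fun q : {p : Fin d × Fin d // p.1 < p.2} => q.1.1) h)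
      simp [ha, hb, hne]

/-- Two parallel sheets differing in the second coordinate by `n` cobound a link set. -/
theorem exists_coboundary_eq_sheetAt_snd_add {i j : Fin d} (hij : i < j) (a b : ZMod L) (n : ℕ) :
    ∃ E : Finset (Edge d L), coboundary E = sheetAt i j hij a b ∆ sheetAt i j hij a (b + (n : ZMod L)) := by
  induction n with
  | zero => exact ⟨∅, by rw [coboundary_empty', Nat.cast_zero, add_zero, symmDiff_self]; rfl⟩
  | succ n ih =>
    obtain ⟨E, hE⟩ := ih
    refine ⟨E ∆ sheetLinksSnd i j a (b + (n : ZMod L)), ?_⟩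
    rw [coboundary_symmDiff, hE, coboundary_sheetLinksSnd hij, Nat.cast_succ, ← add_assoc, symmDiff_assoc,
      symmDiff_symmDiff_cancel_left]

/-- **Any two parallel sheets of the `(i, j)` plane cobound a link set** (both coordinates). -/
theorem exists_coboundary_eq_sheetAt {i j : Fin d} (hij : i < j) (a b a' b' : ZMod L) :
    ∃ E : Finset (Edge d L), coboundary E = sheetAt i j hij a b ∆ sheetAt i j hij a' b' := by
  obtain ⟨E₁, hE₁⟩ := exists_coboundary_eq_sheetAt_fst (L := L) hij a a' b
  obtain ⟨E₂, hE₂⟩ := exists_coboundary_eq_sheetAt_snd_add (L := L) hij a' b (b' - b).val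
  rw [ZMod.natCast_zmod_val, add_sub_cancel] at hE₂
  refine ⟨E₁ ∆ E₂, ?_⟩
  rw [coboundary_symmDiff, hE₁, hE₂, symmDiff_assoc, symmDiff_symmDiff_cancel_left]

/-- **The sheet-twisted partition functions do not depend on the location of the sheet**, for every exponent field. -/
theorem tPowFieldZ_sheetAt_eq (J : ℕ) (c : ℕ → ℝ) {i j : Fin d} (hij : i < j) (a b a' b' : ZMod L) (e : Plaquette d L → ℕ) :
    tPowFieldZ J c (sheetAt i j hij a b) e = tPowFieldZ J c (sheetAt i j hij a' b') e := by
  obtain ⟨E, hE⟩ := exists_coboundary_eq_sheetAt (L := L) hij a b a' b'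
  exact tPowFieldZ_congr_coboundary J c E hE.symm e

/-- The pull-back of a sheet along a translation is a parallel sheet. -/
theorem pullTwist_sheetAt {i j : Fin d} (hij : i < j) (a b : ZMod L) (v : Site d L) :
    pullTwist v (sheetAt i j hij a b) = sheetAt i j hij (a - v i) (b - v j) := by
  ext p
  rw [mem_pullTwist, mem_sheetAt, mem_sheetAt]
  simp only [plaqShift, Pi.add_apply]
  constructor
  · rintro ⟨h1, h2, h3⟩; exact ⟨h1, by rw [← h2]; ring, by rw [← h3]; ring⟩
  · rintro ⟨h1, h2, h3⟩; exact ⟨h1, by rw [h2]; ring, by rw [h3]; ring⟩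

/-- **Translation invariance of the sheet-twisted partition functions**: `Z⁻(𝒱; e ∘ τ_v) = Z⁻(𝒱; e)` for every `v`, `e`. -/
theorem tPowFieldZ_sheet_comp_plaqShift (J : ℕ) (c : ℕ → ℝ) {i j : Fin d} (hij : i < j) (e : Plaquette d L → ℕ)
    (v : Site d L) :
    tPowFieldZ J c (vortexSheet L i j hij) (fun p => e (plaqShift v p)) = tPowFieldZ J c (vortexSheet L i j hij) e := by
  rw [vortexSheet_eq_sheetAt]
  have h := tPowFieldZ_comp_plaqShift J c (sheetAt i j hij (v i) (v j)) e v
  rw [pullTwist_sheetAt, sub_self, sub_self] at h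
  rw [h]
  exact tPowFieldZ_sheetAt_eq J c hij _ _ _ _ e

end Basic

/-! ### The elementary move along one direction, with a twist -/

section Move

variable (b : ℕ) [NeZero b] [NeZero L]

/-- The factors of the twisted integrand not touched by the move (plaquettes containing `κ`). -/
def tRestFn (J : ℕ) (c : ℕ → ℝ) (V : Finset (Plaquette d (b * L))) (κ : Fin d) (e : Plaquette d (b * L) → ℕ)
    (W : GaugeConfig d (b * L) SU2) : ℝ :=
  ∏ p ∈ univ.filter (fun p => κ ∉ perpDirs p), twR J c V p (plaqRe rhoFund W p) ^ e p

/-- The factors of the twisted integrand on the plaquettes `⊥ κ` of residue `i`. -/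
def tSliceFn (J : ℕ) (c : ℕ → ℝ) (V : Finset (Plaquette d (b * L))) (κ : Fin d) (e : Plaquette d (b * L) → ℕ) (i : ZMod b)
    (W : GaugeConfig d (b * L) SU2) : ℝ :=
  ∏ p ∈ (univ.filter (fun p => κ ∈ perpDirs p)).filter (fun p => resb b L (p.1 κ) = i), twR J c V p (plaqRe rhoFund W p) ^ e p

/-- `∏_p f^{e_p} = rest × ∏_{i mod b} slice_i` (twisted). -/
theorem tPowFieldFn_eq_rest_mul_prod_slice (J : ℕ) (c : ℕ → ℝ) (V : Finset (Plaquette d (b * L))) (κ : Fin d)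
    (e : Plaquette d (b * L) → ℕ) (W : GaugeConfig d (b * L) SU2) :
    tPowFieldFn J c V e W = tRestFn b J c V κ e W * ∏ i : ZMod b, tSliceFn b J c V κ e i W := by
  unfold tPowFieldFn tRestFn tSliceFn
  rw [Finset.prod_fiberwise (univ.filter (fun p => κ ∈ perpDirs p)) (fun p : Plaquette d (b * L) => resb b L (p.1 κ))
    (fun p => twR J c V p (plaqRe rhoFund W p) ^ e p),
    ← Finset.prod_filter_mul_prod_filter_not univ (fun p => κ ∈ perpDirs p) (fun p => twR J c V p (plaqRe rhoFund W p) ^ e p),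
    mul_comm]

/-- `∏_p f^{(slice_i e)_p} = rest × slice_i^b` (twisted). -/
theorem tPowFieldFn_sliceExp (J : ℕ) (c : ℕ → ℝ) (V : Finset (Plaquette d (b * L))) (κ : Fin d)
    (e : Plaquette d (b * L) → ℕ) (i : ZMod b) (W : GaugeConfig d (b * L) SU2) :
    tPowFieldFn J c V (sliceExp b κ e i) W = tRestFn b J c V κ e W * tSliceFn b J c V κ e i W ^ b := by
  unfold tPowFieldFn tRestFn tSliceFn
  rw [← Finset.prod_filter_mul_prod_filter_not univ (fun p => κ ∈ perpDirs p), mul_comm]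
  congr 1
  · refine Finset.prod_congr rfl fun p hp => ?_
    rw [sliceExp, if_neg (Finset.mem_filter.1 hp).2]
  · rw [← Finset.prod_pow, Finset.prod_filter (fun p : Plaquette d (b * L) => resb b L (p.1 κ) = i)]
    refine Finset.prod_congr rfl fun p hp => ?_
    rw [sliceExp, if_pos (Finset.mem_filter.1 hp).2]
    split_ifs with h
    · rw [pow_mul']
    · rw [pow_zero]

/-- **AM–GM for the twisted move**: pointwise, `∏_p f^{e_p} ≤ b⁻¹ Σ_{i mod b} ∏_p f^{(slice_i e)_p}` on `f_c ≥ 0`. -/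
theorem tPowFieldFn_le_avg_slice (J : ℕ) {c : ℕ → ℝ} (hf : ∀ g : SU2, 0 ≤ plaqFn J c g) (V : Finset (Plaquette d (b * L)))
    (κ : Fin d) (e : Plaquette d (b * L) → ℕ) (W : GaugeConfig d (b * L) SU2) :
    tPowFieldFn J c V e W ≤ ∑ i : ZMod b, (b : ℝ)⁻¹ * tPowFieldFn J c V (sliceExp b κ e i) W := by
  have hfp : ∀ p : Plaquette d (b * L), 0 ≤ twR J c V p (plaqRe rhoFund W p) := fun p => by
    rw [twR_plaqRe_eq]; split_ifs <;> exact hf _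
  have hR : 0 ≤ tRestFn b J c V κ e W := Finset.prod_nonneg fun p _ => pow_nonneg (hfp p) _
  have hP : ∀ i, 0 ≤ tSliceFn b J c V κ e i W := fun i => Finset.prod_nonneg fun p _ => pow_nonneg (hfp p) _
  have hb0 : (b : ℝ) ≠ 0 := Nat.cast_ne_zero.2 (NeZero.ne b)
  have hamgm := Real.geom_mean_le_arith_mean_weighted (Finset.univ : Finset (ZMod b)) (fun _ => (b : ℝ)⁻¹)
    (fun i => tSliceFn b J c V κ e i W ^ b) (fun _ _ => by positivity)
    (by rw [Finset.sum_const, Finset.card_univ, ZMod.card, nsmul_eq_mul, mul_inv_cancel₀ hb0])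
    (fun i _ => pow_nonneg (hP i) b)
  have hgeo : ∏ i : ZMod b, (tSliceFn b J c V κ e i W ^ b) ^ ((b : ℝ)⁻¹) = ∏ i : ZMod b, tSliceFn b J c V κ e i W :=
    Finset.prod_congr rfl fun i _ => Real.pow_rpow_inv_natCast (hP i) (NeZero.ne b)
  rw [hgeo] at hamgm
  simp_rw [tPowFieldFn_sliceExp]
  rw [tPowFieldFn_eq_rest_mul_prod_slice b J c V κ e W]
  calc tRestFn b J c V κ e W * ∏ i : ZMod b, tSliceFn b J c V κ e i W
      ≤ tRestFn b J c V κ e W * ∑ i : ZMod b, (b : ℝ)⁻¹ * tSliceFn b J c V κ e i W ^ b :=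
        mul_le_mul_of_nonneg_left hamgm hR
    _ = ∑ i : ZMod b, (b : ℝ)⁻¹ * (tRestFn b J c V κ e W * tSliceFn b J c V κ e i W ^ b) := by
        rw [Finset.mul_sum]
        refine Finset.sum_congr rfl fun i _ => ?_
        ring

/-- **The elementary twisted potential-moving step is an upper bound**: `Z⁻(V; e) ≤ Z⁻(V; move_κ e)` for every exponent
field `e` invariant under the unit translation along `κ`, every twist set `V` whose twisted partition functions are invariant
under translations along `κ` (the vortex sheet: `tPowFieldZ_sheet_comp_plaqShift`), on the positivity domain `f_c ≥ 0`.
[cite: Tomboulis2007Confinement, App. A §4, (A.15)–(A.18) and the twisted paragraph after (A.19)] -/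
theorem tPowFieldZ_le_tPowFieldZ_moveExp (J : ℕ) {c : ℕ → ℝ} (hf : ∀ g : SU2, 0 ≤ plaqFn J c g)
    {V : Finset (Plaquette d (b * L))} (κ : Fin d)
    (hV : ∀ (z : ZMod (b * L)) (e' : Plaquette d (b * L) → ℕ),
      tPowFieldZ J c V (fun p => e' (plaqShift (Pi.single κ z) p)) = tPowFieldZ J c V e')
    {e : Plaquette d (b * L) → ℕ} (he : ∀ p, e (plaqShift (Pi.single κ 1) p) = e p) :
    tPowFieldZ J c V e ≤ tPowFieldZ J c V (moveExp b κ e) := by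
  have hint : ∀ e' : Plaquette d (b * L) → ℕ, Integrable (tPowFieldFn J c V e')
      (Measure.pi fun _ : Edge d (b * L) => haarProbability SU2) :=
    fun e' => integrable_pi_su2_of_continuous (continuous_tPowFieldFn J c V e')
  calc tPowFieldZ J c V e
      ≤ ∫ W, ∑ i : ZMod b, (b : ℝ)⁻¹ * tPowFieldFn J c V (sliceExp b κ e i) W
          ∂(Measure.pi fun _ : Edge d (b * L) => haarProbability SU2) :=
        integral_mono (hint e) (integrable_finsetSum _ fun i _ => (hint _).const_mul _)
          fun W => tPowFieldFn_le_avg_slice b J hf V κ e W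
    _ = ∑ i : ZMod b, (b : ℝ)⁻¹ * tPowFieldZ J c V (sliceExp b κ e i) := by
        rw [integral_finsetSum _ fun i _ => (hint _).const_mul _]
        refine Finset.sum_congr rfl fun i _ => ?_
        rw [integral_const_mul]
        rfl
    _ = ∑ i : ZMod b, (b : ℝ)⁻¹ * tPowFieldZ J c V (moveExp b κ e) := by
        refine Finset.sum_congr rfl fun i _ => ?_
        rw [sliceExp_eq_moveExp_comp_plaqShift b κ he i, hV]
    _ = tPowFieldZ J c V (moveExp b κ e) := by
        rw [Finset.sum_const, Finset.card_univ, ZMod.card, nsmul_eq_mul, ← mul_assoc,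
          mul_inv_cancel₀ (Nat.cast_ne_zero.2 (NeZero.ne b)), one_mul]

/-- **Twisted potential moving along any set of directions bounds `Z⁻` above**: `Z⁻_{(ℤ/bL)^d}({c_j}) ≤ Z⁻(𝒱; mkExpS S)`. -/
theorem torusZtw_le_tPowFieldZ_mkExpS (J : ℕ) {c : ℕ → ℝ} (hf : ∀ g : SU2, 0 ≤ plaqFn J c g) {i j : Fin d} (hij : i < j)
    (S : Finset (Fin d)) :
    torusZtw d (b * L) J c (vortexSheet (b * L) i j hij) ≤ tPowFieldZ J c (vortexSheet (b * L) i j hij) (mkExpS (L := L) b S) := by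
  induction S using Finset.induction_on with
  | empty => rw [mkExpS_empty, torusZtw_eq_tPowFieldZ_one]
  | insert κ S hκ ih =>
    calc torusZtw d (b * L) J c (vortexSheet (b * L) i j hij) ≤ tPowFieldZ J c (vortexSheet (b * L) i j hij) (mkExpS b S) := ih
      _ ≤ tPowFieldZ J c (vortexSheet (b * L) i j hij) (moveExp b κ (mkExpS b S)) :=
          tPowFieldZ_le_tPowFieldZ_moveExp b J hf κ (fun z e' => tPowFieldZ_sheet_comp_plaqShift J c hij e' _)
            (mkExpS_plaqShift_single b hκ)
      _ = tPowFieldZ J c (vortexSheet (b * L) i j hij) (mkExpS b (insert κ S)) := by rw [moveExp_mkExpS b hκ]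

/-- **Twisted potential moving bounds `Z⁻` above** (the inequality half of the twisted analogue (UAtwist) of
arXiv:0707.2179 (A.19)): on the positivity domain `f_c ≥ 0`, for every `d`, `b ≥ 1`, `L ≥ 1`, cut-off `J` and plane `(i, j)`,
`Z⁻_{(ℤ/bL)^d}({c_j}) ≤ ∫ ∏_{p on the coarse 2-skeleton} f_c(∓U_p)^{b^{d-2}} ∏_b dU_b`, the sign `-` exactly on the sheet `𝒱_{ij}`.
[cite: Tomboulis2007Confinement, App. A §4, twisted paragraph after (A.19)] -/
theorem torusZtw_fine_le_tPowFieldZ_mkExp (J : ℕ) {c : ℕ → ℝ} (hf : ∀ g : SU2, 0 ≤ plaqFn J c g) {i j : Fin d} (hij : i < j) :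
    torusZtw d (b * L) J c (vortexSheet (b * L) i j hij) ≤
      tPowFieldZ J c (vortexSheet (b * L) i j hij) (fun p : Plaquette d (b * L) =>
        if ∀ κ ∈ perpDirs p, resb b L (p.1 κ) = 0 then b ^ (d - 2) else 0) := by
  have h := torusZtw_le_tPowFieldZ_mkExpS (L := L) b J hf hij (univ : Finset (Fin d))
  have hfun : mkExpS (L := L) b (univ : Finset (Fin d)) = fun p : Plaquette d (b * L) =>
      if ∀ κ ∈ perpDirs p, resb b L (p.1 κ) = 0 then b ^ (d - 2) else 0 := funext fun p => mkExpS_univ b p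
  rwa [hfun] at h

end Move

end Summit.Ventures.YMGap.Census

end
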